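import Summits.RiemannHypothesis.RiemannHypothesis.Theorems.SoloInformedGroundStateSubstrip

/-!
# Ground-state endgame, IV: the unconditional Bessel bound, counting, the off-line budget

Solo programme `solo-RiemannHypothesis-informed`, session 1 — part of the assembled endgame of
the semilocal (Weil ground state) programme (Connes 2026, arXiv:2602.04022, §6.6); overview in
`SoloInformedGroundStateLimit.lean`. Everything here is proved; the only named fact used anywhere
in the package is `Connes2026_weilGroundState_zeros_re_eq_half` (C–vS Thm. 6.1), as a hypothesis.

`norm_weilZeroSidePartial_weilQuadratic_le` (`|Q(g)| ≤ Σ_ρ m(ρ)|ĝ(ρ)|²`, explicit formula,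
no RH), `connesLawUpper_of_pointwise` (a pointwise bound at the zeros suffices), and the honest
form of the wall `re_weilZeroSidePartial_weilQuadratic_ge`: the negativity budget of Weil's
functional is the off-line zero sum (`riemannHypothesis_of_offline_zeroSums_nonpos`).
-/

noncomputable section

open Complex Filter Set Topology Metric MeasureTheory
open Literature.NumberTheory.LFunctions

namespace Summit.RiemannHypothesis.RiemannHypothesis.Theorems

/-! ## (I) The unconditional Bessel bound `|Q(g)| ≤ Σ_ρ m(ρ)|ĝ(ρ)|²` (explicit formula, no RH)

Step 3 of the memo's proof sketch of `ConnesLawUpper` (paper/upper.md), kernel-checked: Weil's explicit formula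
(`explicit_formula_holds`, in the tree) writes `Q(g) = lim_T Σ_{|Im ρ| ≤ T} m(ρ) ĝ(ρ) conj ĝ(1 − ρ̄)`; pairing `ρ` with
`1 − ρ̄` (a multiplicity-preserving involution of the zero set, `riemannZetaZeroOrder_one_sub_conj`) and `2|ab| ≤ |a|²+|b|²`
bound every truncation by `Σ m(ρ)|ĝ(ρ)|²`.  Hence an explicit window test vector whose transform is small AT THE ZEROS
(wherever they are) has small Rayleigh quotient — which is how the identity `k̂_λ = ζ·M(h_λ) − T_λ` is to be cashed. -/

section ZeroSide

open scoped ComplexConjugate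

/-- Zeros indexed by the Weil zero side lie in the open critical strip. -/
theorem re_pos_and_lt_one_of_mem_weilZeroIndex {T : ℝ} {ρ : ℂ} (h : ρ ∈ weilZeroIndex T) :
    0 < ρ.re ∧ ρ.re < 1 := by
  obtain ⟨hζ, -, -, him, -⟩ := h
  have hmem : ρ ∈ ZetaZeros.riemannZetaNontrivialZeros := by
    refine ⟨Set.mem_singleton_iff.2 hζ, ?_⟩
    rintro ⟨n, hn⟩
    have := congrArg Complex.im hn
    simp at this
    exact him this.symm
  exact (mem_riemannZetaNontrivialZeros_iff_holds.1 hmem).2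

/-- The involution `ρ ↦ 1 - conj ρ` preserves the Weil zero index. -/
theorem one_sub_conj_mem_weilZeroIndex {T : ℝ} {ρ : ℂ} (h : ρ ∈ weilZeroIndex T) :
    1 - conj ρ ∈ weilZeroIndex T := by
  obtain ⟨h0, h1⟩ := re_pos_and_lt_one_of_mem_weilZeroIndex h
  obtain ⟨hζ, -, -, him, hT⟩ := h
  have hne1 : ρ ≠ 1 := by
    rintro rfl
    simp at him
  have hne1' : 1 - conj ρ ≠ 1 := by
    intro h'
    have := congrArg Complex.im h'
    simp at this
    exact him this
  have hord : 0 < riemannZetaZeroOrder (1 - conj ρ) := by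
    rw [riemannZetaZeroOrder_one_sub_conj h0 h1]
    exact (riemannZetaZeroOrder_pos_iff hne1).2 hζ
  refine ⟨(riemannZetaZeroOrder_pos_iff hne1').1 hord, ?_, ?_, ?_, ?_⟩
  · simp; linarith
  · simp; linarith
  · simpa using him
  · simpa using hT

/-- **Unconditional Bessel bound for the truncated zero side of `Q(g)`**: by `(g ⋆ g̃)^(ρ) = ĝ(ρ)·conj ĝ(1-ρ̄)`,
`2|ab| ≤ |a|² + |b|²`, and the symmetry `ρ ↦ 1 - ρ̄` of the zeros with multiplicity,
`|∑_{|Im ρ| ≤ T} m(ρ) (g ⋆ g̃)^(ρ)| ≤ ∑_{|Im ρ| ≤ T} m(ρ) |ĝ(ρ)|²` — no Riemann hypothesis. -/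
theorem norm_weilZeroSidePartial_weilQuadratic_le {g : ℝ → ℂ} (hg : IsWeilTest g) (T : ℝ) :
    ‖weilZeroSidePartial (weilConv g (weilReflect g)) T‖ ≤
      ∑ᶠ ρ ∈ weilZeroIndex T, (riemannZetaZeroOrder ρ : ℝ) * ‖weilMellin g ρ‖ ^ 2 := by
  have hfin := weilZeroIndex_finite T
  have hmem : ∀ ρ, ρ ∈ hfin.toFinset ↔ ρ ∈ weilZeroIndex T := fun ρ ↦ hfin.mem_toFinset
  unfold weilZeroSidePartial
  rw [finsum_mem_eq_finite_toFinset_sum _ hfin, finsum_mem_eq_finite_toFinset_sum _ hfin]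
  have hm0 : ∀ ρ ∈ hfin.toFinset, 0 ≤ (riemannZetaZeroOrder ρ : ℝ) := by
    intro ρ hρ
    obtain ⟨-, -, -, him, -⟩ := (hmem ρ).1 hρ
    have hne : ρ ≠ 1 := by
      rintro rfl
      simp at him
    exact_mod_cast riemannZetaZeroOrder_nonneg hne
  have hterm : ∀ ρ ∈ hfin.toFinset,
      ‖(riemannZetaZeroOrder ρ : ℂ) * weilMellin (weilConv g (weilReflect g)) ρ‖ ≤
        ((riemannZetaZeroOrder ρ : ℝ) * ‖weilMellin g ρ‖ ^ 2 +
          (riemannZetaZeroOrder ρ : ℝ) * ‖weilMellin g (1 - conj ρ)‖ ^ 2) / 2 := by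
    intro ρ hρ
    rw [weilMellin_weilQuadratic hg, norm_mul, norm_mul, Complex.norm_conj, Complex.norm_intCast,
      abs_of_nonneg (hm0 ρ hρ)]
    have h2 := two_mul_le_add_sq ‖weilMellin g ρ‖ ‖weilMellin g (1 - conj ρ)‖
    nlinarith [norm_nonneg (weilMellin g ρ), norm_nonneg (weilMellin g (1 - conj ρ)), hm0 ρ hρ]
  have hreindex : ∑ ρ ∈ hfin.toFinset, (riemannZetaZeroOrder ρ : ℝ) * ‖weilMellin g (1 - conj ρ)‖ ^ 2 =
      ∑ ρ ∈ hfin.toFinset, (riemannZetaZeroOrder ρ : ℝ) * ‖weilMellin g ρ‖ ^ 2 := by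
    refine Finset.sum_nbij' (fun ρ ↦ 1 - conj ρ) (fun ρ ↦ 1 - conj ρ) ?_ ?_ ?_ ?_ ?_
    · intro ρ hρ
      exact (hmem _).2 (one_sub_conj_mem_weilZeroIndex ((hmem ρ).1 hρ))
    · intro ρ hρ
      exact (hmem _).2 (one_sub_conj_mem_weilZeroIndex ((hmem ρ).1 hρ))
    · intro ρ _
      simp
    · intro ρ _
      simp
    · intro ρ hρ
      obtain ⟨h0, h1⟩ := re_pos_and_lt_one_of_mem_weilZeroIndex ((hmem ρ).1 hρ)
      simp only [riemannZetaZeroOrder_one_sub_conj h0 h1]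
  calc ‖∑ ρ ∈ hfin.toFinset, (riemannZetaZeroOrder ρ : ℂ) * weilMellin (weilConv g (weilReflect g)) ρ‖
      ≤ ∑ ρ ∈ hfin.toFinset, ‖(riemannZetaZeroOrder ρ : ℂ) * weilMellin (weilConv g (weilReflect g)) ρ‖ :=
        norm_sum_le _ _
    _ ≤ ∑ ρ ∈ hfin.toFinset, ((riemannZetaZeroOrder ρ : ℝ) * ‖weilMellin g ρ‖ ^ 2 +
          (riemannZetaZeroOrder ρ : ℝ) * ‖weilMellin g (1 - conj ρ)‖ ^ 2) / 2 :=
        Finset.sum_le_sum hterm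
    _ = ∑ ρ ∈ hfin.toFinset, (riemannZetaZeroOrder ρ : ℝ) * ‖weilMellin g ρ‖ ^ 2 := by
        rw [← Finset.sum_div, Finset.sum_add_distrib, hreindex]
        ring

/-- **`|Q(g)| ≤ sup_T ∑_{|Im ρ| ≤ T} m(ρ)|ĝ(ρ)|²`, unconditionally** (explicit formula `explicit_formula_holds` +
the Bessel bound on every truncation + continuity of the norm). This is the inequality through which UPPER bounds on
ground energies are proved from explicit test vectors (memo paper/upper.md, Step 3). -/
theorem norm_weilQuadratic_le_of_zeroSum_le {g : ℝ → ℂ} (hg : IsWeilTest g) {B : ℝ}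
    (hB : ∀ T : ℝ, ∑ᶠ ρ ∈ weilZeroIndex T, (riemannZetaZeroOrder ρ : ℝ) * ‖weilMellin g ρ‖ ^ 2 ≤ B) :
    ‖weilQuadratic g‖ ≤ B := by
  have hk : IsWeilTest (weilConv g (weilReflect g)) := hg.weilConv hg.weilReflect
  have hlim : Tendsto (fun T ↦ ‖weilZeroSidePartial (weilConv g (weilReflect g)) T‖) atTop
      (𝓝 ‖weilQuadratic g‖) :=
    (continuous_norm.tendsto _).comp (explicit_formula_holds hk)
  exact le_of_tendsto' hlim fun T ↦ (norm_weilZeroSidePartial_weilQuadratic_le hg T).trans (hB T)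

/-- Real-part form. -/
theorem re_weilQuadratic_le_of_zeroSum_le {g : ℝ → ℂ} (hg : IsWeilTest g) {B : ℝ}
    (hB : ∀ T : ℝ, ∑ᶠ ρ ∈ weilZeroIndex T, (riemannZetaZeroOrder ρ : ℝ) * ‖weilMellin g ρ‖ ^ 2 ≤ B) :
    (weilQuadratic g).re ≤ B :=
  ((le_abs_self _).trans (Complex.abs_re_le_norm _)).trans (norm_weilQuadratic_le_of_zeroSum_le hg hB)

/-- **`ConnesLawUpper` from explicit window tests with small zero sums** (Steps 3–5 of paper/upper.md reduce to
exhibiting these vectors; what remains on paper is the prolate analysis bounding `Σ_ρ m(ρ)|ĝ(ρ)|²` for the mollified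
`k_λ`, via `ĝ(ρ) = −T_λ(ρ)·φ̂_δ(ρ)` at every zero). -/
theorem connesLawUpper_of_zeroSums {C B : ℝ}
    (h : ∀ a : ℝ, 1 ≤ a → ∃ k : ℝ → ℂ, IsWeilTest k ∧ tsupport k ⊆ Icc (-a) a ∧ 0 < ∫ t : ℝ, ‖k t‖ ^ 2 ∧
      ∀ T : ℝ, ∑ᶠ ρ ∈ weilZeroIndex T, (riemannZetaZeroOrder ρ : ℝ) * ‖weilMellin k ρ‖ ^ 2 ≤
        C * Real.exp (2 * a) ^ B * Real.exp (-(4 * Real.pi * Real.exp (2 * a))) * ∫ t : ℝ, ‖k t‖ ^ 2) :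
    ConnesLawUpper :=
  connesLawUpper_of_explicit fun a ha ↦ by
    obtain ⟨k, hk, hs, hpos, hT⟩ := h a ha
    exact ⟨k, hk, hs, hpos, re_weilQuadratic_le_of_zeroSum_le hk hT⟩

end ZeroSide

/-! ## (J) Counting: a pointwise bound at the zeros suffices

With the tree's unconditional `weilZeroSummable` (`Σ_ρ m(ρ)/(1+γ²)² < ∞`, Jensen + `N(T+1) − N(T) ≪ log T`), the zero
sums of (I) are bounded by a pointwise bound `|ĝ(ρ)|² ≤ A/(1+γ²)²` at the non-trivial zeros.  So the provable half of
Connes's law is reduced, in Lean, to: for every large window exhibit ONE smooth test `k` supported in it with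
`|k̂(ρ)| ≤ √(C μ^B e^{−4πμ}) ‖k‖₂ /(1+γ²)` at every non-trivial zero `ρ = β + iγ` — exactly what the identity
`k̂ = ζ·M(h) − T` delivers for the mollified prolate vector (paper/upper.md Steps 1–2, 4–5). -/

section Counting

open scoped ComplexConjugate

/-- A real-valued `finsum` over the Weil zero index is the `Finset` sum over `weilZeroFinset T`. -/
theorem finsum_weilZeroIndex_eq_sum (f : ℂ → ℝ) (T : ℝ) :
    ∑ᶠ ρ ∈ weilZeroIndex T, f ρ = ∑ ρ ∈ weilZeroFinset T, f ρ := by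
  classical
  have e : ∑ ρ ∈ weilZeroFinset T, f ρ =
      ∑ z ∈ (weilZeroFinset T).map (Function.Embedding.subtype _), f z := by
    rw [Finset.sum_map]
    rfl
  rw [e, finsum_mem_eq_finite_toFinset_sum _ (weilZeroIndex_finite T)]
  refine Finset.sum_congr ?_ fun _ _ ↦ rfl
  ext z
  simp only [Set.Finite.mem_toFinset, Finset.mem_map, Function.Embedding.subtype_apply]
  constructor
  · intro hz
    rw [weilZeroIndex_eq_inter] at hz
    exact ⟨⟨z, hz.1⟩, mem_weilZeroFinset.2 hz.2, rfl⟩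
  · rintro ⟨ρ, hρ, rfl⟩
    rw [weilZeroIndex_eq_inter]
    exact ⟨ρ.2, mem_weilZeroFinset.1 hρ⟩

/-- **Counting step**: a pointwise bound `|ĝ(ρ)|² ≤ A/(1+γ²)²` at the non-trivial zeros bounds every truncated zero sum
by `A · Σ_ρ m(ρ)/(1+γ²)²` (the tree's unconditional `weilZeroSummable`, Jensen/`N(T+1)−N(T) ≪ log T`). -/
theorem zeroSum_le_of_norm_sq_le {g : ℝ → ℂ} {A : ℝ} (hA : 0 ≤ A)
    (h : ∀ ρ ∈ ZetaZeros.riemannZetaNontrivialZeros, ‖weilMellin g ρ‖ ^ 2 ≤ A / (1 + ρ.im ^ 2) ^ 2)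
    (T : ℝ) :
    ∑ᶠ ρ ∈ weilZeroIndex T, (riemannZetaZeroOrder ρ : ℝ) * ‖weilMellin g ρ‖ ^ 2 ≤
      A * ∑' ρ : ZetaZeros.riemannZetaNontrivialZeros, weilZeroWeight (ρ : ℂ) := by
  rw [finsum_weilZeroIndex_eq_sum (fun ρ ↦ (riemannZetaZeroOrder ρ : ℝ) * ‖weilMellin g ρ‖ ^ 2), ← tsum_mul_left]
  have hle : ∀ ρ : ZetaZeros.riemannZetaNontrivialZeros,
      (riemannZetaZeroOrder (ρ : ℂ) : ℝ) * ‖weilMellin g ρ‖ ^ 2 ≤ A * weilZeroWeight (ρ : ℂ) := by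
    intro ρ
    have hm : (0 : ℝ) ≤ riemannZetaZeroOrder (ρ : ℂ) := by
      exact_mod_cast riemannZetaZeroOrder_nonneg (ZetaZeros.riemannZetaNontrivialZeros.ne_one ρ.2)
    calc (riemannZetaZeroOrder (ρ : ℂ) : ℝ) * ‖weilMellin g ρ‖ ^ 2
        ≤ (riemannZetaZeroOrder (ρ : ℂ) : ℝ) * (A / (1 + (ρ : ℂ).im ^ 2) ^ 2) :=
          mul_le_mul_of_nonneg_left (h ρ ρ.2) hm
      _ = A * weilZeroWeight (ρ : ℂ) := by
          rw [weilZeroWeight]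
          ring
  calc ∑ ρ ∈ weilZeroFinset T, (riemannZetaZeroOrder (ρ : ℂ) : ℝ) * ‖weilMellin g ρ‖ ^ 2
      ≤ ∑ ρ ∈ weilZeroFinset T, A * weilZeroWeight (ρ : ℂ) := Finset.sum_le_sum fun ρ _ ↦ hle ρ
    _ ≤ ∑' ρ : ZetaZeros.riemannZetaNontrivialZeros, A * weilZeroWeight (ρ : ℂ) :=
        (weilZeroSummable.mul_left A).sum_le_tsum _ fun ρ _ ↦ mul_nonneg hA (weilZeroWeight_nonneg ρ.2)

/-- **`ConnesLawUpper` from a pointwise bound at the non-trivial zeros** (the whole of Step 3 of paper/upper.md,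
kernel-checked: explicit formula + Bessel pairing + zero counting). -/
theorem connesLawUpper_of_pointwise {C B : ℝ} (hC : 0 ≤ C)
    (h : ∀ a : ℝ, 1 ≤ a → ∃ k : ℝ → ℂ, IsWeilTest k ∧ tsupport k ⊆ Icc (-a) a ∧ 0 < ∫ t : ℝ, ‖k t‖ ^ 2 ∧
      ∀ ρ ∈ ZetaZeros.riemannZetaNontrivialZeros, ‖weilMellin k ρ‖ ^ 2 ≤
        (C * Real.exp (2 * a) ^ B * Real.exp (-(4 * Real.pi * Real.exp (2 * a))) * ∫ t : ℝ, ‖k t‖ ^ 2) /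
          (1 + ρ.im ^ 2) ^ 2) :
    ConnesLawUpper := by
  set W : ℝ := ∑' ρ : ZetaZeros.riemannZetaNontrivialZeros, weilZeroWeight (ρ : ℂ) with hW
  refine connesLawUpper_of_zeroSums (C := C * W) (B := B) fun a ha ↦ ?_
  obtain ⟨k, hk, hs, hpos, hρ⟩ := h a ha
  refine ⟨k, hk, hs, hpos, fun T ↦ ?_⟩
  have hB : 0 < Real.exp (2 * a) ^ B := Real.rpow_pos_of_pos (Real.exp_pos _) _
  have hA : 0 ≤ C * Real.exp (2 * a) ^ B * Real.exp (-(4 * Real.pi * Real.exp (2 * a))) * ∫ t : ℝ, ‖k t‖ ^ 2 :=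
    mul_nonneg (mul_nonneg (mul_nonneg hC hB.le) (Real.exp_pos _).le) hpos.le
  calc ∑ᶠ ρ ∈ weilZeroIndex T, (riemannZetaZeroOrder ρ : ℝ) * ‖weilMellin k ρ‖ ^ 2
      ≤ (C * Real.exp (2 * a) ^ B * Real.exp (-(4 * Real.pi * Real.exp (2 * a))) * ∫ t : ℝ, ‖k t‖ ^ 2) * W :=
        zeroSum_le_of_norm_sq_le hA hρ T
    _ = C * W * Real.exp (2 * a) ^ B * Real.exp (-(4 * Real.pi * Real.exp (2 * a))) * ∫ t : ℝ, ‖k t‖ ^ 2 := by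
        ring

end Counting

/-! ## (K) The negativity budget is the off-line zero sum (the honest form of the wall)

Unconditionally, `Re Q(g) ≥ − limsup_T Σ_{|Im ρ| ≤ T, Re ρ ≠ 1/2} m(ρ)|ĝ(ρ)|²`: on-line zeros contribute squares, off-line
zeros pair under `ρ ↦ 1 − ρ̄`.  So `ε(a) ≥ − sup_{‖g‖₂ = 1} (off-line zero sum of g)`, and every lower bound on a ground
energy (the wall: `ConnesLawLower`, eventual positivity) is EXACTLY a bound on how much mass window test functions can
put on off-line zeros — nothing more is available from the explicit formula. -/

section Offline

open scoped ComplexConjugate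

/-- **The negativity budget is the off-line zero sum** (unconditional): for every test function `g` and every
truncation height `T`, `Re Σ_{|Im ρ| ≤ T} m(ρ)(g ⋆ g̃)^(ρ) ≥ − Σ_{|Im ρ| ≤ T, Re ρ ≠ 1/2} m(ρ)|ĝ(ρ)|²`: the on-line
zeros contribute `m(ρ)|ĝ(ρ)|² ≥ 0`, the off-line ones pair up under `ρ ↦ 1 − ρ̄`. -/
theorem re_weilZeroSidePartial_weilQuadratic_ge {g : ℝ → ℂ} (hg : IsWeilTest g) (T : ℝ) :
    -(∑ᶠ ρ ∈ weilZeroIndex T ∩ {ρ | ρ.re ≠ 1 / 2}, (riemannZetaZeroOrder ρ : ℝ) * ‖weilMellin g ρ‖ ^ 2) ≤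
      (weilZeroSidePartial (weilConv g (weilReflect g)) T).re := by
  classical
  have hfin := weilZeroIndex_finite T
  have hfin' : (weilZeroIndex T ∩ {ρ | ρ.re ≠ 1 / 2}).Finite := hfin.subset inter_subset_left
  have hmem : ∀ ρ, ρ ∈ hfin.toFinset ↔ ρ ∈ weilZeroIndex T := fun ρ ↦ hfin.mem_toFinset
  -- the off-line part of the index, as a filter of the finset
  have hoff : hfin'.toFinset = hfin.toFinset.filter (fun ρ ↦ ρ.re ≠ 1 / 2) := by
    ext ρ
    simp [Set.Finite.mem_toFinset, Finset.mem_filter, weilZeroIndex]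
  unfold weilZeroSidePartial
  rw [finsum_mem_eq_finite_toFinset_sum _ hfin, finsum_mem_eq_finite_toFinset_sum _ hfin', hoff]
  set F := hfin.toFinset with hF
  have hm0 : ∀ ρ ∈ F, 0 ≤ (riemannZetaZeroOrder ρ : ℝ) := by
    intro ρ hρ
    obtain ⟨-, -, -, him, -⟩ := (hmem ρ).1 hρ
    have hne : ρ ≠ 1 := by
      rintro rfl
      simp at him
    exact_mod_cast riemannZetaZeroOrder_nonneg hne
  -- split the sum into on-line and off-line parts
  rw [← Finset.sum_filter_add_sum_filter_not F (fun ρ ↦ ρ.re ≠ 1 / 2), Complex.add_re]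
  -- on-line part is a sum of non-negative reals
  have hon : 0 ≤ (∑ ρ ∈ F.filter (fun ρ ↦ ¬ρ.re ≠ 1 / 2),
      (riemannZetaZeroOrder ρ : ℂ) * weilMellin (weilConv g (weilReflect g)) ρ).re := by
    rw [Complex.re_sum]
    refine Finset.sum_nonneg fun ρ hρ ↦ ?_
    rw [Finset.mem_filter, not_not] at hρ
    rw [weilMellin_weilQuadratic_of_re_eq hg hρ.2, ← Complex.ofReal_intCast, ← Complex.ofReal_mul,
      Complex.ofReal_re]
    exact mul_nonneg (hm0 ρ hρ.1) (Complex.normSq_nonneg _)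
  -- off-line part: Bessel pairing inside the off-line set
  set G := F.filter (fun ρ ↦ ρ.re ≠ 1 / 2) with hG
  have hGmem : ∀ ρ, ρ ∈ G ↔ ρ ∈ weilZeroIndex T ∧ ρ.re ≠ 1 / 2 := fun ρ ↦ by
    rw [hG, Finset.mem_filter, hmem]
  have hterm : ∀ ρ ∈ G,
      ‖(riemannZetaZeroOrder ρ : ℂ) * weilMellin (weilConv g (weilReflect g)) ρ‖ ≤
        ((riemannZetaZeroOrder ρ : ℝ) * ‖weilMellin g ρ‖ ^ 2 +
          (riemannZetaZeroOrder ρ : ℝ) * ‖weilMellin g (1 - conj ρ)‖ ^ 2) / 2 := by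
    intro ρ hρ
    have hρF : ρ ∈ F := (Finset.mem_filter.1 hρ).1
    rw [weilMellin_weilQuadratic hg, norm_mul, norm_mul, Complex.norm_conj, Complex.norm_intCast,
      abs_of_nonneg (hm0 ρ hρF)]
    have h2 := two_mul_le_add_sq ‖weilMellin g ρ‖ ‖weilMellin g (1 - conj ρ)‖
    nlinarith [norm_nonneg (weilMellin g ρ), norm_nonneg (weilMellin g (1 - conj ρ)), hm0 ρ hρF]
  have hreindex : ∑ ρ ∈ G, (riemannZetaZeroOrder ρ : ℝ) * ‖weilMellin g (1 - conj ρ)‖ ^ 2 =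
      ∑ ρ ∈ G, (riemannZetaZeroOrder ρ : ℝ) * ‖weilMellin g ρ‖ ^ 2 := by
    have hmap : ∀ ρ ∈ G, 1 - conj ρ ∈ G := by
      intro ρ hρ
      obtain ⟨hI, hre⟩ := (hGmem ρ).1 hρ
      refine (hGmem _).2 ⟨one_sub_conj_mem_weilZeroIndex hI, ?_⟩
      intro h'
      apply hre
      simp at h'
      linarith
    refine Finset.sum_nbij' (fun ρ ↦ 1 - conj ρ) (fun ρ ↦ 1 - conj ρ) hmap hmap ?_ ?_ ?_
    · intro ρ _
      simp
    · intro ρ _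
      simp
    · intro ρ hρ
      obtain ⟨h0, h1⟩ := re_pos_and_lt_one_of_mem_weilZeroIndex ((hGmem ρ).1 hρ).1
      simp only [riemannZetaZeroOrder_one_sub_conj h0 h1]
  have hoffle : ‖∑ ρ ∈ G, (riemannZetaZeroOrder ρ : ℂ) * weilMellin (weilConv g (weilReflect g)) ρ‖ ≤
      ∑ ρ ∈ G, (riemannZetaZeroOrder ρ : ℝ) * ‖weilMellin g ρ‖ ^ 2 := by
    calc ‖∑ ρ ∈ G, (riemannZetaZeroOrder ρ : ℂ) * weilMellin (weilConv g (weilReflect g)) ρ‖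
        ≤ ∑ ρ ∈ G, ‖(riemannZetaZeroOrder ρ : ℂ) * weilMellin (weilConv g (weilReflect g)) ρ‖ :=
          norm_sum_le _ _
      _ ≤ ∑ ρ ∈ G, ((riemannZetaZeroOrder ρ : ℝ) * ‖weilMellin g ρ‖ ^ 2 +
            (riemannZetaZeroOrder ρ : ℝ) * ‖weilMellin g (1 - conj ρ)‖ ^ 2) / 2 :=
          Finset.sum_le_sum hterm
      _ = ∑ ρ ∈ G, (riemannZetaZeroOrder ρ : ℝ) * ‖weilMellin g ρ‖ ^ 2 := by
          rw [← Finset.sum_div, Finset.sum_add_distrib, hreindex]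
          ring
  have hre : -‖∑ ρ ∈ G, (riemannZetaZeroOrder ρ : ℂ) * weilMellin (weilConv g (weilReflect g)) ρ‖ ≤
      (∑ ρ ∈ G, (riemannZetaZeroOrder ρ : ℂ) * weilMellin (weilConv g (weilReflect g)) ρ).re := by
    have h1 := Complex.abs_re_le_norm
      (∑ ρ ∈ G, (riemannZetaZeroOrder ρ : ℂ) * weilMellin (weilConv g (weilReflect g)) ρ)
    have h2 := neg_abs_le (∑ ρ ∈ G, (riemannZetaZeroOrder ρ : ℂ) * weilMellin (weilConv g (weilReflect g)) ρ).re
    linarith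
  linarith

/-- **Lower bound by the off-line budget**: if the off-line zero sums of `g` are `≤ B` at every truncation height then
`Re Q(g) ≥ −B` (explicit formula `explicit_formula_holds` + the pairing bound + continuity of `re`). -/
theorem re_weilQuadratic_ge_neg_of_offline_le {g : ℝ → ℂ} (hg : IsWeilTest g) {B : ℝ}
    (hB : ∀ T : ℝ, ∑ᶠ ρ ∈ weilZeroIndex T ∩ {ρ | ρ.re ≠ 1 / 2},
      (riemannZetaZeroOrder ρ : ℝ) * ‖weilMellin g ρ‖ ^ 2 ≤ B) :
    -B ≤ (weilQuadratic g).re := by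
  have hk : IsWeilTest (weilConv g (weilReflect g)) := hg.weilConv hg.weilReflect
  have hlim : Tendsto (fun T ↦ (weilZeroSidePartial (weilConv g (weilReflect g)) T).re) atTop
      (𝓝 (weilQuadratic g).re) :=
    (Complex.continuous_re.tendsto _).comp (explicit_formula_holds hk)
  exact ge_of_tendsto' hlim fun T ↦
    (neg_le_neg (hB T)).trans (re_weilZeroSidePartial_weilQuadratic_ge hg T)

/-- **Weil positivity on a window from vanishing off-line sums** (trivially implied by RH, under which the off-line index
is empty; recorded as the exact shape of what any positivity proof must control). -/
theorem weilPositivityOn_of_offline_zeroSums_nonpos {a : ℝ}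
    (h : ∀ g : ℝ → ℂ, IsWeilTest g → tsupport g ⊆ Icc (-a) a → ∀ T : ℝ,
      ∑ᶠ ρ ∈ weilZeroIndex T ∩ {ρ | ρ.re ≠ 1 / 2}, (riemannZetaZeroOrder ρ : ℝ) * ‖weilMellin g ρ‖ ^ 2 ≤ 0) :
    WeilPositivityOn a := fun g hg hs ↦ by
  simpa using re_weilQuadratic_ge_neg_of_offline_le hg (h g hg hs)

/-- … and therefore RH from eventually vanishing off-line sums on large windows (via
`riemannHypothesis_of_eventually_weilPositivityOn`). -/
theorem riemannHypothesis_of_offline_zeroSums_nonpos {a₀ : ℝ}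
    (h : ∀ a : ℝ, a₀ ≤ a → ∀ g : ℝ → ℂ, IsWeilTest g → tsupport g ⊆ Icc (-a) a → ∀ T : ℝ,
      ∑ᶠ ρ ∈ weilZeroIndex T ∩ {ρ | ρ.re ≠ 1 / 2}, (riemannZetaZeroOrder ρ : ℝ) * ‖weilMellin g ρ‖ ^ 2 ≤ 0) :
    _root_.RiemannHypothesis :=
  riemannHypothesis_of_eventually_weilPositivityOn fun a ha ↦
    weilPositivityOn_of_offline_zeroSums_nonpos (h a ha)

end Offline

end Summit.RiemannHypothesis.RiemannHypothesis.Theorems
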